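import Literature.RepresentationTheory.HeisenbergGroup.WeylSystemVacuumProjection
import Literature.RepresentationTheory.Unitary.CyclicCoefficientRigidity
import Literature.Analysis.SegalBargmann.SchwartzHeisenbergModel
import HarnessLib

/-!
# Uniqueness of the irreducible unitary representation of the real Heisenberg group with central character `𝐞` (von Neumann 1931; Folland 1989 Thm (1.50)) — model-free form

Topic `Analysis/SegalBargmann`; namespace `Literature.Analysis.SegalBargmann`.

**Theorem** (`exists_linearIsometryEquiv_of_irreducible_of_irreducible`).  Any two unitary representations of the
polarised real Heisenberg group `HeisR σ = Heisenberg (polar (dotPairing σ))` on non-zero complex Hilbert spaces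
whose orbit maps `(p,q) ↦ π((p,q),0) v` are continuous, whose centre acts by `ψ_∞ = 𝐞 = e^{2πi·}` and whose only
closed invariant subspaces are `⊥` and `⊤` are unitarily equivalent.  (The Schrödinger representation on `L²(ℝ^σ)`
is such a representation; the equivalence with it is the file `StoneVonNeumannReal`.)

Proof.  §1 identifies the phase space `ℝ^σ × ℝ^σ` with the Euclidean space `V = EuclideanSpace ℝ (σ ⊕ σ)` and its
rotation `J(p,q) = (q,-p)` (a compatible complex structure: skew, isometric, `⟪x, Jy⟫ = p·q' − p'·q`).  §2: the
operators `W(x) = 𝐞(½ p·q) π((p,q),0)` form a Weyl system over `(V, J)` (`isWeylSystem_weylOfRep`), so von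
Neumann's Gaussian vacuum projection (`IsWeylSystem.exists_norm_eq_one_inner_apply_self`,
`RepresentationTheory/HeisenbergGroup/WeylSystemVacuumProjection`) produces a unit vector with the FORCED
diagonal coefficient `⟪π((p,q),t) v, v⟫ = vacuumCoeff σ (p,q) t` (§3, `exists_norm_eq_one_inner_apply_eq`) — the
same function for every such `π`.  §4: two irreducible unitary representations with non-zero vectors of equal
diagonal coefficient are unitarily equivalent (GNS rigidity, `Unitary/CyclicCoefficientRigidity`).
Everything is PROVED (Mathlib + tree); no cited statement is used as a hypothesis.

This is the archimedean counterpart of the tree's non-archimedean uniqueness theorem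
`HeisenbergGroup.exists_linearIsometryEquiv_of_irreducible_unitary` (`GelbartRogawski1991/LocalSchrodingerL2Unique`);
together they cover the local ingredient "`ρ_ψ` … (unique up to isomorphism)" of
[GelbartRogawski1991, §3.1 p. 454 L20–21] at every place.

## References

* [vonNeumann1931] J. von Neumann, Die Eindeutigkeit der Schrödingerschen Operatoren, Math. Ann. 104 (1931)
  570–578, §4.
* [Folland1989] G. B. Folland, *Harmonic Analysis in Phase Space*, Princeton University Press, 1989, §1.1,
  §1.3 (1.25), §1.5 Theorem (1.50), §4.1 (doi:10.1515/9781400882427).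
* [GelbartRogawski1991] S. Gelbart, J. Rogawski, Invent. Math. 105 (1991), §3.1 p. 454 L19–21.
-/

noncomputable section

open MeasureTheory Complex
open scoped InnerProductSpace ComplexConjugate Real FourierTransform

namespace Literature.Analysis.SegalBargmann

open Literature.RepresentationTheory.HeisenbergGroup Literature.RepresentationTheory.Unitary

set_option autoImplicit false

variable (σ : Type*) [Fintype σ]

/-! ## 1. Phase space as a Euclidean space with its rotation `J` -/

/-- The phase space `ℝ^σ × ℝ^σ` as the Euclidean space `ℝ^{σ ⊕ σ}` (inner product `Σ pₖp'ₖ + Σ qₖq'ₖ`).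
[cite: Folland1989, §1.1] -/
abbrev PhaseSpace : Type _ := EuclideanSpace ℝ (σ ⊕ σ)

/-- The coordinates `x ↦ (p, q) = (x ∘ inl, x ∘ inr)` of a point of phase space. [cite: Folland1989, §1.1] -/
def phaseEquiv : PhaseSpace σ ≃ₗ[ℝ] (σ → ℝ) × (σ → ℝ) :=
  (WithLp.linearEquiv 2 ℝ (σ ⊕ σ → ℝ)).trans (LinearEquiv.sumArrowLequivProdArrow σ σ ℝ ℝ)

omit [Fintype σ] in
/-- first coordinate block. [cite: Folland1989, §1.1] -/
@[simp] theorem phaseEquiv_apply_fst (x : PhaseSpace σ) (k : σ) : (phaseEquiv σ x).1 k = x (Sum.inl k) := rfl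

omit [Fintype σ] in
/-- second coordinate block. [cite: Folland1989, §1.1] -/
@[simp] theorem phaseEquiv_apply_snd (x : PhaseSpace σ) (k : σ) : (phaseEquiv σ x).2 k = x (Sum.inr k) := rfl

/-- The Euclidean inner product in coordinates: `⟪x, y⟫ = p·p' + q·q'`. [cite: Folland1989, §1.1] -/
theorem inner_phaseSpace (x y : PhaseSpace σ) :
    ⟪x, y⟫_ℝ = (phaseEquiv σ x).1 ⬝ᵥ (phaseEquiv σ y).1 + (phaseEquiv σ x).2 ⬝ᵥ (phaseEquiv σ y).2 := by
  rw [EuclideanSpace.inner_eq_star_dotProduct, star_trivial, dotProduct, Fintype.sum_sum_type]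
  simp only [dotProduct, phaseEquiv_apply_fst, phaseEquiv_apply_snd]
  congr 1 <;> exact Finset.sum_congr rfl fun k _ => mul_comm _ _

/-- The rotation `J(p, q) = (q, -p)` of phase space (multiplication by `-i` on `p + iq`; a compatible complex
structure). [cite: Folland1989, §4.1] -/
def Jrot : PhaseSpace σ →ₗ[ℝ] PhaseSpace σ :=
  (phaseEquiv σ).symm.toLinearMap ∘ₗ
    ((LinearMap.snd ℝ (σ → ℝ) (σ → ℝ)).prod (-LinearMap.fst ℝ (σ → ℝ) (σ → ℝ))) ∘ₗ (phaseEquiv σ).toLinearMap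

omit [Fintype σ] in
/-- `J` in coordinates. [cite: Folland1989, §4.1] -/
@[simp] theorem phaseEquiv_Jrot (x : PhaseSpace σ) :
    phaseEquiv σ (Jrot σ x) = ((phaseEquiv σ x).2, -(phaseEquiv σ x).1) := by
  simp [Jrot]

/-- `J` is skew: `⟪J x, y⟫ = -⟪x, J y⟫`. [cite: Folland1989, §4.1] -/
theorem inner_Jrot_left (x y : PhaseSpace σ) : ⟪Jrot σ x, y⟫_ℝ = -⟪x, Jrot σ y⟫_ℝ := by
  rw [inner_phaseSpace, inner_phaseSpace, phaseEquiv_Jrot, phaseEquiv_Jrot]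
  simp only [neg_dotProduct, dotProduct_neg]
  rw [dotProduct_comm (phaseEquiv σ x).2, dotProduct_comm (phaseEquiv σ x).1]
  ring

/-- `J` is isometric. [cite: Folland1989, §4.1] -/
theorem norm_Jrot (x : PhaseSpace σ) : ‖Jrot σ x‖ = ‖x‖ := by
  rw [norm_eq_sqrt_real_inner (Jrot σ x), norm_eq_sqrt_real_inner x, inner_phaseSpace, inner_phaseSpace,
    phaseEquiv_Jrot]
  simp only [neg_dotProduct, dotProduct_neg, neg_neg]
  rw [add_comm]

/-- The symplectic form of `J` is the standard one: `⟪x, J y⟫ = p·q' − p'·q`. [cite: Folland1989, §1.1, §4.1] -/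
theorem inner_Jrot_right (x y : PhaseSpace σ) :
    ⟪x, Jrot σ y⟫_ℝ = (phaseEquiv σ x).1 ⬝ᵥ (phaseEquiv σ y).2 - (phaseEquiv σ y).1 ⬝ᵥ (phaseEquiv σ x).2 := by
  rw [inner_phaseSpace, phaseEquiv_Jrot]
  simp only [dotProduct_neg]
  rw [dotProduct_comm (phaseEquiv σ x).2]
  ring

/-- `phaseEquiv` is continuous. [cite: Folland1989, §1.1] -/
theorem continuous_phaseEquiv : Continuous (phaseEquiv σ) :=
  (phaseEquiv σ).toLinearMap.continuous_of_finiteDimensional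

/-! ## 2. The Weyl system of a unitary representation of `HeisR σ` -/

section Rep

variable {E : Type*} [NormedAddCommGroup E] [InnerProductSpace ℂ E]
variable (ρ : Representation ℂ (HeisR σ) E) (hρu : ∀ (h : HeisR σ) (v : E), ‖ρ h v‖ = ‖v‖)

/-- `ρ(h)` as a bounded operator (it is an isometry). [cite: Folland1989, §1.3 (1.25)] -/
def repCLM (h : HeisR σ) : E →L[ℂ] E :=
  LinearMap.mkContinuous (ρ h) 1 fun v => by rw [one_mul, hρu]

/-- unfolding. [cite: Folland1989, §1.3 (1.25)] -/
@[simp] theorem repCLM_apply (h : HeisR σ) (v : E) : repCLM σ ρ hρu h v = ρ h v := rfl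

/-- **The Weyl system of `ρ`**: `W(x) = 𝐞(½ p·q) ρ((p,q), 0)` for `x = (p, q)` (the symmetric operators,
Folland's `ρ(p,q)`). [cite: Folland1989, §1.3 (1.25)] -/
def weylOfRep (x : PhaseSpace σ) : E →L[ℂ] E :=
  ((𝐞 ((phaseEquiv σ x).1 ⬝ᵥ (phaseEquiv σ x).2 / 2) : Circle) : ℂ) • repCLM σ ρ hρu ⟨phaseEquiv σ x, 0⟩

/-- unfolding. [cite: Folland1989, §1.3 (1.25)] -/
theorem weylOfRep_apply (x : PhaseSpace σ) (v : E) :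
    weylOfRep σ ρ hρu x v = ((𝐞 ((phaseEquiv σ x).1 ⬝ᵥ (phaseEquiv σ x).2 / 2) : Circle) : ℂ) •
      ρ ⟨phaseEquiv σ x, 0⟩ v := rfl

variable {σ ρ}

/-- With central character `𝐞`: `ρ((w, t)) = 𝐞(t) • ρ((w, 0))`. [cite: Folland1989, §1.3 (1.25)] -/
theorem apply_mk_eq_smul
    (hρz : ∀ (t : ℝ) (v : E), ρ (Heisenberg.ofCenter (polar (dotPairing σ)) (Multiplicative.ofAdd t)) v =
      ((𝐞 t : Circle) : ℂ) • v)
    (w : (σ → ℝ) × (σ → ℝ)) (t : ℝ) (v : E) : ρ ⟨w, t⟩ v = ((𝐞 t : Circle) : ℂ) • ρ ⟨w, 0⟩ v := by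
  rw [← Heisenberg.ofVec_mul_ofCenter, map_mul, Module.End.mul_apply, hρz, map_smul]
  rfl

variable {hρu}

/-- **The symmetric operators of a unitary `𝐞`-representation of `HeisR σ` with continuous orbit maps form a
Weyl system** over `(EuclideanSpace ℝ (σ ⊕ σ), J)`. [cite: Folland1989, §1.3 (1.25), §1.5 Theorem (1.50)] -/
theorem isWeylSystem_weylOfRep (hρc : ∀ v : E, Continuous fun w : (σ → ℝ) × (σ → ℝ) => ρ ⟨w, 0⟩ v)
    (hρz : ∀ (t : ℝ) (v : E), ρ (Heisenberg.ofCenter (polar (dotPairing σ)) (Multiplicative.ofAdd t)) v =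
      ((𝐞 t : Circle) : ℂ) • v) :
    IsWeylSystem (Jrot σ) (weylOfRep σ ρ hρu) where
  inner_J_left := inner_Jrot_left σ
  norm_J := norm_Jrot σ
  mul x y u := by
    have hexy : phaseEquiv σ (x + y) = phaseEquiv σ x + phaseEquiv σ y := map_add _ _ _
    have hmul : ρ ⟨phaseEquiv σ x, 0⟩ (ρ ⟨phaseEquiv σ y, 0⟩ u) =
        ((𝐞 ((phaseEquiv σ x).1 ⬝ᵥ (phaseEquiv σ y).2) : Circle) : ℂ) •
          ρ ⟨phaseEquiv σ x + phaseEquiv σ y, 0⟩ u := by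
      rw [← Module.End.mul_apply, ← map_mul, Heisenberg.mk_mul_mk]
      simp only [zero_add, polar_apply, dotPairing_apply]
      exact apply_mk_eq_smul hρz _ _ _
    rw [weylOfRep_apply, weylOfRep_apply, weylOfRep_apply, map_smul, hmul, smul_smul, smul_smul, smul_smul,
      fourierChar_coe_mul, fourierChar_coe_mul, fourierChar_coe_mul, hexy]
    congr 3
    simp only [inner_Jrot_right, Prod.fst_add, Prod.snd_add, add_dotProduct, dotProduct_add]
    rw [dotProduct_comm (phaseEquiv σ y).1 (phaseEquiv σ x).2]
    ring
  norm_map x u := by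
    rw [weylOfRep_apply, norm_smul, Circle.norm_coe, one_mul, hρu]
  continuous u := by
    simp only [weylOfRep_apply]
    refine Continuous.smul ?_ ((hρc u).comp (continuous_phaseEquiv σ))
    refine (continuous_subtype_val.comp Real.continuous_fourierChar).comp ?_
    refine Continuous.div_const (Continuous.dotProduct ?_ ?_) _
    · exact continuous_fst.comp (continuous_phaseEquiv σ)
    · exact continuous_snd.comp (continuous_phaseEquiv σ)

end Rep

/-! ## 3. The forced diagonal coefficient of a vacuum vector -/

/-- **The vacuum coefficient** of the real Heisenberg group: `c((p,q),t) = conj 𝐞(t) · 𝐞(½ p·q) · e^{-(π/2)(|p|²+|q|²)}`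
— the diagonal coefficient `⟪ρ((p,q),t) v, v⟫` of ANY unit vacuum vector of ANY unitary `𝐞`-representation
(`exists_norm_eq_one_inner_apply_eq`). [cite: Folland1989, §1.5 proof of Theorem (1.50), (1.72)] -/
def vacuumCoeff (w : (σ → ℝ) × (σ → ℝ)) (t : ℝ) : ℂ :=
  conj ((𝐞 t : Circle) : ℂ) * ((𝐞 (w.1 ⬝ᵥ w.2 / 2) : Circle) : ℂ) * (RepresentationTheory.HeisenbergGroup.gauss ((phaseEquiv σ).symm w) : ℂ)

section Rep

variable {E : Type*} [NormedAddCommGroup E] [InnerProductSpace ℂ E] [CompleteSpace E]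

variable {σ} in
/-- **Every unitary `𝐞`-representation of `HeisR σ` with continuous orbit maps on a non-zero Hilbert space has a
unit vector with diagonal coefficient `vacuumCoeff`** (von Neumann's Gaussian projection applied to its Weyl system).
[cite: vonNeumann1931, §4; Folland1989, §1.5 Theorem (1.50)] -/
theorem exists_norm_eq_one_inner_apply_eq [Nontrivial E] (ρ : Representation ℂ (HeisR σ) E)
    (hρu : ∀ (h : HeisR σ) (v : E), ‖ρ h v‖ = ‖v‖)
    (hρc : ∀ v : E, Continuous fun w : (σ → ℝ) × (σ → ℝ) => ρ ⟨w, 0⟩ v)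
    (hρz : ∀ (t : ℝ) (v : E), ρ (Heisenberg.ofCenter (polar (dotPairing σ)) (Multiplicative.ofAdd t)) v =
      ((𝐞 t : Circle) : ℂ) • v) :
    ∃ v : E, ‖v‖ = 1 ∧ ∀ (w : (σ → ℝ) × (σ → ℝ)) (t : ℝ), ⟪ρ ⟨w, t⟩ v, v⟫_ℂ = vacuumCoeff σ w t := by
  obtain ⟨v, hv1, -, hcoef⟩ := (isWeylSystem_weylOfRep (hρu := hρu) hρc hρz).exists_norm_eq_one_inner_apply_self
  refine ⟨v, hv1, fun w t => ?_⟩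
  have h1 := hcoef ((phaseEquiv σ).symm w)
  rw [weylOfRep_apply, LinearEquiv.apply_symm_apply, inner_smul_left] at h1
  set c : ℂ := ((𝐞 (w.1 ⬝ᵥ w.2 / 2) : Circle) : ℂ) with hc
  have hcc : c * conj c = 1 := by
    rw [hc, Complex.mul_conj, Circle.normSq_coe, Complex.ofReal_one]
  have h2 : ⟪ρ ⟨w, 0⟩ v, v⟫_ℂ = c * (RepresentationTheory.HeisenbergGroup.gauss ((phaseEquiv σ).symm w) : ℂ) := by
    rw [← h1, ← mul_assoc, hcc, one_mul]
  rw [apply_mk_eq_smul hρz, inner_smul_left, h2, vacuumCoeff, mul_assoc]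

end Rep

/-! ## 4. Uniqueness, model-free form -/

/-- **Any two irreducible unitary `𝐞`-representations of `HeisR σ` with continuous orbit maps are unitarily
equivalent** (model-free form of the theorem). [cite: vonNeumann1931, §4; Folland1989, §1.5 Theorem (1.50)] -/
theorem exists_linearIsometryEquiv_of_irreducible_of_irreducible {E₁ : Type*} [NormedAddCommGroup E₁] [InnerProductSpace ℂ E₁]
    [CompleteSpace E₁] [Nontrivial E₁] {E₂ : Type*} [NormedAddCommGroup E₂] [InnerProductSpace ℂ E₂]
    [CompleteSpace E₂] [Nontrivial E₂] (ρ₁ : Representation ℂ (HeisR σ) E₁) (ρ₂ : Representation ℂ (HeisR σ) E₂)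
    (h₁u : ∀ (h : HeisR σ) (v : E₁), ‖ρ₁ h v‖ = ‖v‖) (h₂u : ∀ (h : HeisR σ) (v : E₂), ‖ρ₂ h v‖ = ‖v‖)
    (h₁c : ∀ v : E₁, Continuous fun w : (σ → ℝ) × (σ → ℝ) => ρ₁ ⟨w, 0⟩ v)
    (h₂c : ∀ v : E₂, Continuous fun w : (σ → ℝ) × (σ → ℝ) => ρ₂ ⟨w, 0⟩ v)
    (h₁z : ∀ (t : ℝ) (v : E₁), ρ₁ (Heisenberg.ofCenter (polar (dotPairing σ)) (Multiplicative.ofAdd t)) v =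
      ((𝐞 t : Circle) : ℂ) • v)
    (h₂z : ∀ (t : ℝ) (v : E₂), ρ₂ (Heisenberg.ofCenter (polar (dotPairing σ)) (Multiplicative.ofAdd t)) v =
      ((𝐞 t : Circle) : ℂ) • v)
    (h₁i : ∀ K : Submodule ℂ E₁, IsClosed (K : Set E₁) → (∀ (h : HeisR σ), ∀ v ∈ K, ρ₁ h v ∈ K) → K = ⊥ ∨ K = ⊤)
    (h₂i : ∀ K : Submodule ℂ E₂, IsClosed (K : Set E₂) → (∀ (h : HeisR σ), ∀ v ∈ K, ρ₂ h v ∈ K) → K = ⊥ ∨ K = ⊤) :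
    ∃ U : E₁ ≃ₗᵢ[ℂ] E₂, ∀ (h : HeisR σ) (v : E₁), U (ρ₁ h v) = ρ₂ h (U v) := by
  obtain ⟨v₁, hv₁1, hv₁⟩ := exists_norm_eq_one_inner_apply_eq ρ₁ h₁u h₁c h₁z
  obtain ⟨v₂, hv₂1, hv₂⟩ := exists_norm_eq_one_inner_apply_eq ρ₂ h₂u h₂c h₂z
  have hv₁0 : v₁ ≠ 0 := by rw [← norm_ne_zero_iff, hv₁1]; exact one_ne_zero
  have hv₂0 : v₂ ≠ 0 := by rw [← norm_ne_zero_iff, hv₂1]; exact one_ne_zero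
  have hcoef : ∀ h : HeisR σ, ⟪ρ₁ h v₁, v₁⟫_ℂ = ⟪ρ₂ h v₂, v₂⟫_ℂ := fun h => by
    obtain ⟨w, t⟩ := h
    rw [hv₁, hv₂]
  obtain ⟨U, -, hU⟩ := exists_linearIsometryEquiv_of_irreducible ρ₁ ρ₂ h₁u h₂u h₁i h₂i hv₁0 hv₂0 hcoef
  exact ⟨U, hU⟩

end Literature.Analysis.SegalBargmann

end
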